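import Summits.Ventures.CertifiedManyBodySolver.Downfold.EmeryOrbitalWeightFaceDirBox
import Summits.Ventures.CertifiedManyBodySolver.Downfold.EmeryVanHoveSubBox
import Summits.Ventures.CertifiedManyBodySolver.Downfold.EmeryVanHoveTableB
import Summits.Ventures.CertifiedManyBodySolver.Downfold.EmeryVanHoveTableF
import Summits.Ventures.CertifiedManyBodySolver.Downfold.EmeryFermiFaceDirPointsTl2223IPK11NH114S1
import Summits.Ventures.CertifiedManyBodySolver.Downfold.EmeryFermiFaceDirPointsTl2223IPK11NH114S2
import Summits.Ventures.CertifiedManyBodySolver.Downfold.EmeryFermiFaceDirPointsTl2223IPK11NH114S3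
import HarnessLib

/-!
# THE ANTINODAL FERMI-SURFACE Cu-d WEIGHT OVER THE TYPED 3BE BOX `emeryBoxTl2223IPK11Src (EmeryBoxesKSlicesS)` AT FILLING n_H = 1.14 (ν = 43/100), regime-free rule v2 — the kinematic leg of the UPPER member
# `U_B∣full(w_antinode)` of the weak band-level `U` bracket read over a box where the v1 rule's antinodal charge-transfer regime FAILS at the low-Δ corners
# (INFL-3to1-B §B.90 (j); kernel `EmeryOrbitalWeightFaceDirBox`; router/EMERY-FS-WEIGHT-BRACKETS.tsv / OBJECT-E-BUDGET.tsv §C)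

Venture CertifiedManyBodySolver, cell `pub/hubbard-downfold` (stage S1), seat hubbard-downfold-mod-4 (technique B, g39); namespace
`Summit.Ventures.CertifiedManyBodySolver.Downfold.Emery`. Everything PROVED (0 sorry). WHAT THIS IS NOT: a statement about the material — the typed box (Tl₂Ba₂Ca₂Cu₃O₁₀ INNER plane ((K) source box))
is SCREENING-GRADE; `U = 0` one-body kinematics of the σ model; the `U_B` arithmetic that consumes the window is DERIVED context on the MEAN-FIELD annex (R-B17).

For every member θ = (Δ, t_pd, t_pp, t_pp′) ∈ [1.48, 2.24] × [1.18, 1.39] × [0.62, 0.73] × [0.15, 0.19] eV at filling ν = 43/100, the Cu-d weight of the ANTINODAL Bloch state,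
`dWeightFace θ (fermiEnergyOf θ ν)`, lies in the window below. DEVICE (v2): `W(θ) = W(Δ/t_pd, 1, t_pp/t_pd, t_pp′/t_pd)` (scaling law); the t_pd range is cut into 3 slabs; on each
normalised slab the v2 CORNER RULE `dWeightFace_fermiEnergyOf_mem_Icc_of_mem_box3_dir_num`: Δ ↑ at fixed filling WITHOUT the regime (region-wide directional certificate
`faceDir_nonneg_of_mem_region`, κ₀ = 1/10, + the Fermi-energy slope law κ = 1/10 + mean value theorem), t_pp ↓, t_pp′ ↑ only at the upper corner (regime margin R2 there),
lower end `t_pp′`-decoupled (`dWeightFaceLoDec` at `E_h`); hole-likeness from the slab's `vhBoxCheck` + the Ψ table; two K = 384 Fermi-energy brackets per slab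
(`EmeryFermiFaceDirPointsTl2223IPK11NH114S<k>`). The slab corners are VIRTUAL (not members): the window is a sound ENCLOSURE (lower end ≈ 0.02 below the v1 virtual-corner value).

| t_pd slab (eV) | normalised slab Δ/t_pd × t_pp/t_pd × t_pp′/t_pd | q₁ (vhBoxCheck) ≥ table point | E_h | E_v | margins (R2, 1 − κ − w̄_axis) | **w_face window** |
|---|---|---|---|---|---|---|
| [1.18, 1.25] | [1.184, 1.898] × [0.496, 0.6186] × [0.12, 0.161] | 0.5704 ≥ 14/25 (Ψ ≤ 0.3858) | 1.4749 | 1.1595 | +0.430, +0.135 | **[0.6314, 0.7503]** |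
| [1.25, 1.32] | [1.121, 1.792] × [0.4697, 0.584] × [0.1136, 0.152] | 0.5488 ≥ 27/50 (Ψ ≤ 0.3881) | 1.4922 | 1.1898 | +0.495, +0.146 | **[0.627, 0.7406]** |
| [1.32, 1.39] | [1.065, 1.697] × [0.446, 0.553] × [0.1079, 0.1439] | 0.5283 ≥ 21/40 (Ψ ≤ 0.3899) | 1.5086 | 1.2178 | +0.555, +0.156 | **[0.6228, 0.7315]** |
| **whole box** | (hull of the slabs) | | | | | **[0.6228, 0.7503]** |

Sources: three-band model [HybertsenSchluterChristensen1989, Eq. (1)]; face point of the bilinear contour [AndersenEtAl1995, §6]; [folklore] algebra.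
-/

noncomputable section

namespace Summit.Ventures.CertifiedManyBodySolver.Downfold.Emery

open Real Set

/-- **Slab 1 (t_pd ∈ [1.18, 1.25] eV) of `emeryBoxTl2223IPK11Src (EmeryBoxesKSlicesS)`, ν = 43/100: the antinodal Fermi-surface Cu-d weight of every member lies in `[0.6314, 0.7503]`**
(normalised-slab v2 corner rule; brackets `faceDirPt_Tl2223IPK11_nH114_s1_lo_br` / `_hi_br`). [folklore] -/
theorem tl2223IPK11Box_dWeightFaceDir_nH114_s1 {Δ a b c : ℝ} (hΔ : Δ ∈ Icc ((37 : ℝ) / 25) ((56 : ℝ) / 25)) (ha : a ∈ Icc ((59 : ℝ) / 50) ((5 : ℝ) / 4)) (hb : b ∈ Icc ((31 : ℝ) / 50) ((73 : ℝ) / 100)) (hc : c ∈ Icc ((3 : ℝ) / 20) ((19 : ℝ) / 100)) :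
    dWeightFace Δ a b c (fermiEnergyOf Δ a b c ((43 : ℝ) / 100)) ∈ Icc ((3157 : ℝ) / 5000) ((7503 : ℝ) / 10000) := by
  have ha0 : 0 < a := lt_of_lt_of_le (by norm_num) ha.1
  rw [dWeightFace_fermiEnergyOf_eq_ratios ha0]
  have hΔn : Δ / a ∈ Icc ((148 : ℝ) / 125) ((112 : ℝ) / 59) := by
    constructor
    · rw [le_div_iff₀ ha0]; linarith [hΔ.1, ha.2]
    · rw [div_le_iff₀ ha0]; linarith [hΔ.2, ha.1]
  have hbn : b / a ∈ Icc ((62 : ℝ) / 125) ((73 : ℝ) / 118) := by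
    constructor
    · rw [le_div_iff₀ ha0]; linarith [hb.1, ha.2]
    · rw [div_le_iff₀ ha0]; linarith [hb.2, ha.1]
  have hcn : c / a ∈ Icc ((3 : ℝ) / 25) ((19 : ℝ) / 118) := by
    constructor
    · rw [le_div_iff₀ ha0]; linarith [hc.1, ha.2]
    · rw [div_le_iff₀ ha0]; linarith [hc.2, ha.1]
  have hVH : ∀ Δ' b' c' : ℝ, Δ' ∈ Icc ((148 : ℝ) / 125) ((112 : ℝ) / 59) → b' ∈ Icc ((62 : ℝ) / 125) ((73 : ℝ) / 118) → c' ∈ Icc ((3 : ℝ) / 25) ((19 : ℝ) / 118) →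
      1 - 2 * ((43 : ℝ) / 100) ≤ xVH Δ' 1 b' c' := by
    intro Δ' b' c' hΔ' hb' hc'
    have h := xVH_window_of_vhBoxCheck (Δ₁ := ((148 : ℚ) / 125)) (Δ₂ := ((112 : ℚ) / 59)) (a₁ := (1 : ℚ)) (a₂ := (1 : ℚ)) (b₁ := ((62 : ℚ) / 125)) (b₂ := ((73 : ℚ) / 118))
      (c₁ := ((3 : ℚ) / 25)) (c₂ := ((19 : ℚ) / 118)) (v₁ := ((5493 : ℚ) / 5000)) (v₂ := ((6671 : ℚ) / 5000)) (e := ((12849 : ℚ) / 10000)) (E := ((11377 : ℚ) / 10000))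
      (q₁ := ((713 : ℚ) / 1250)) (q₂ := ((2061 : ℚ) / 2000)) (by decide +kernel)
      (Δ := Δ') (tpd := 1) (tpp := b') (c := c') (by simpa using hΔ') (by simp) (by simpa using hb') (by simpa using hc')
    obtain ⟨-, -, -, -, -, hwin⟩ := h
    push_cast at hwin
    have ht := vhFrac_14_25
    have hmono := vhFrac_anti (show (14 / 25 : ℝ) ≤ ((713 : ℝ) / 1250) by norm_num)
    have hnu : ((56885 : ℝ) / 147456) ≤ ((43 : ℝ) / 100) := by norm_num
    linarith [hwin.1, ht.2]
  have hEh := (fermiEnergyOf_of_pointBracketCheck faceDirPt_Tl2223IPK11_nH114_s1_lo_br (by norm_num) (by norm_num) (by norm_num) (ν := (43/100 : ℝ))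
    (by push_cast; exact ⟨le_rfl, le_rfl⟩)).2
  have hEv := (fermiEnergyOf_of_pointBracketCheck faceDirPt_Tl2223IPK11_nH114_s1_hi_br (by norm_num) (by norm_num) (by norm_num) (ν := (43/100 : ℝ))
    (by push_cast; exact ⟨le_rfl, le_rfl⟩)).2
  push_cast at hEh hEv
  refine dWeightFace_fermiEnergyOf_mem_Icc_of_mem_box3_dir_num (Eh := ((14749 : ℝ) / 10000)) (Ev := ((2319 : ℝ) / 2000)) (Elow := ((2299 : ℝ) / 2000)) (κ₀ := 1 / 10) (κ := 1 / 10)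
    (by norm_num) one_pos (by norm_num) (by norm_num) (by norm_num) hΔn hbn hcn (by norm_num) (by norm_num) hVH hEh.2 (by norm_num)
    (by norm_num [faceU, fsD, fsN, cA]) (by norm_num [faceU, fsD, fsN, cA]) (by norm_num [faceU, fsD, fsN, cA]) (by norm_num [faceU, fsD, fsN, cA])
    hEv.1 (by norm_num) (by norm_num) (by norm_num [faceG]) (by norm_num) (by norm_num) (by norm_num) le_rfl (by norm_num [dWeightAxisCF])
    (by norm_num) (by norm_num) ?_ (by norm_num [dWeightFaceLoDec, faceRUp, faceN]) (by norm_num [dWeightFaceCF, faceN, faceR, fsN])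
  intro D B C e hD hB hC he hG
  exact faceDir_nonneg_of_mem_region ⟨le_trans (by norm_num) hD.1, le_trans hD.2 (by norm_num)⟩ ⟨le_trans (by norm_num) he.1, le_trans he.2 (by norm_num)⟩
    ⟨le_trans (by norm_num) hB.1, le_trans hB.2 (by norm_num)⟩ ⟨le_trans (by norm_num) hC.1, le_trans hC.2 (by norm_num)⟩ hG

/-- **Slab 2 (t_pd ∈ [1.25, 1.32] eV) of `emeryBoxTl2223IPK11Src (EmeryBoxesKSlicesS)`, ν = 43/100: the antinodal Fermi-surface Cu-d weight of every member lies in `[0.627, 0.7406]`**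
(normalised-slab v2 corner rule; brackets `faceDirPt_Tl2223IPK11_nH114_s2_lo_br` / `_hi_br`). [folklore] -/
theorem tl2223IPK11Box_dWeightFaceDir_nH114_s2 {Δ a b c : ℝ} (hΔ : Δ ∈ Icc ((37 : ℝ) / 25) ((56 : ℝ) / 25)) (ha : a ∈ Icc ((5 : ℝ) / 4) ((33 : ℝ) / 25)) (hb : b ∈ Icc ((31 : ℝ) / 50) ((73 : ℝ) / 100)) (hc : c ∈ Icc ((3 : ℝ) / 20) ((19 : ℝ) / 100)) :
    dWeightFace Δ a b c (fermiEnergyOf Δ a b c ((43 : ℝ) / 100)) ∈ Icc ((627 : ℝ) / 1000) ((3703 : ℝ) / 5000) := by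
  have ha0 : 0 < a := lt_of_lt_of_le (by norm_num) ha.1
  rw [dWeightFace_fermiEnergyOf_eq_ratios ha0]
  have hΔn : Δ / a ∈ Icc ((37 : ℝ) / 33) ((224 : ℝ) / 125) := by
    constructor
    · rw [le_div_iff₀ ha0]; linarith [hΔ.1, ha.2]
    · rw [div_le_iff₀ ha0]; linarith [hΔ.2, ha.1]
  have hbn : b / a ∈ Icc ((31 : ℝ) / 66) ((73 : ℝ) / 125) := by
    constructor
    · rw [le_div_iff₀ ha0]; linarith [hb.1, ha.2]
    · rw [div_le_iff₀ ha0]; linarith [hb.2, ha.1]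
  have hcn : c / a ∈ Icc ((5 : ℝ) / 44) ((19 : ℝ) / 125) := by
    constructor
    · rw [le_div_iff₀ ha0]; linarith [hc.1, ha.2]
    · rw [div_le_iff₀ ha0]; linarith [hc.2, ha.1]
  have hVH : ∀ Δ' b' c' : ℝ, Δ' ∈ Icc ((37 : ℝ) / 33) ((224 : ℝ) / 125) → b' ∈ Icc ((31 : ℝ) / 66) ((73 : ℝ) / 125) → c' ∈ Icc ((5 : ℝ) / 44) ((19 : ℝ) / 125) →
      1 - 2 * ((43 : ℝ) / 100) ≤ xVH Δ' 1 b' c' := by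
    intro Δ' b' c' hΔ' hb' hc'
    have h := xVH_window_of_vhBoxCheck (Δ₁ := ((37 : ℚ) / 33)) (Δ₂ := ((224 : ℚ) / 125)) (a₁ := (1 : ℚ)) (a₂ := (1 : ℚ)) (b₁ := ((31 : ℚ) / 66)) (b₂ := ((73 : ℚ) / 125))
      (c₁ := ((5 : ℚ) / 44)) (c₂ := ((19 : ℚ) / 125)) (v₁ := ((11323 : ℚ) / 10000)) (v₂ := ((6809 : ℚ) / 5000)) (e := ((6571 : ℚ) / 5000)) (E := ((5853 : ℚ) / 5000))
      (q₁ := ((343 : ℚ) / 625)) (q₂ := ((4849 : ℚ) / 5000)) (by decide +kernel)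
      (Δ := Δ') (tpd := 1) (tpp := b') (c := c') (by simpa using hΔ') (by simp) (by simpa using hb') (by simpa using hc')
    obtain ⟨-, -, -, -, -, hwin⟩ := h
    push_cast at hwin
    have ht := vhFrac_27_50
    have hmono := vhFrac_anti (show (27 / 50 : ℝ) ≤ ((343 : ℝ) / 625) by norm_num)
    have hnu : ((57230 : ℝ) / 147456) ≤ ((43 : ℝ) / 100) := by norm_num
    linarith [hwin.1, ht.2]
  have hEh := (fermiEnergyOf_of_pointBracketCheck faceDirPt_Tl2223IPK11_nH114_s2_lo_br (by norm_num) (by norm_num) (by norm_num) (ν := (43/100 : ℝ))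
    (by push_cast; exact ⟨le_rfl, le_rfl⟩)).2
  have hEv := (fermiEnergyOf_of_pointBracketCheck faceDirPt_Tl2223IPK11_nH114_s2_hi_br (by norm_num) (by norm_num) (by norm_num) (ν := (43/100 : ℝ))
    (by push_cast; exact ⟨le_rfl, le_rfl⟩)).2
  push_cast at hEh hEv
  refine dWeightFace_fermiEnergyOf_mem_Icc_of_mem_box3_dir_num (Eh := ((7461 : ℝ) / 5000)) (Ev := ((5949 : ℝ) / 5000)) (Elow := ((5899 : ℝ) / 5000)) (κ₀ := 1 / 10) (κ := 1 / 10)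
    (by norm_num) one_pos (by norm_num) (by norm_num) (by norm_num) hΔn hbn hcn (by norm_num) (by norm_num) hVH hEh.2 (by norm_num)
    (by norm_num [faceU, fsD, fsN, cA]) (by norm_num [faceU, fsD, fsN, cA]) (by norm_num [faceU, fsD, fsN, cA]) (by norm_num [faceU, fsD, fsN, cA])
    hEv.1 (by norm_num) (by norm_num) (by norm_num [faceG]) (by norm_num) (by norm_num) (by norm_num) le_rfl (by norm_num [dWeightAxisCF])
    (by norm_num) (by norm_num) ?_ (by norm_num [dWeightFaceLoDec, faceRUp, faceN]) (by norm_num [dWeightFaceCF, faceN, faceR, fsN])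
  intro D B C e hD hB hC he hG
  exact faceDir_nonneg_of_mem_region ⟨le_trans (by norm_num) hD.1, le_trans hD.2 (by norm_num)⟩ ⟨le_trans (by norm_num) he.1, le_trans he.2 (by norm_num)⟩
    ⟨le_trans (by norm_num) hB.1, le_trans hB.2 (by norm_num)⟩ ⟨le_trans (by norm_num) hC.1, le_trans hC.2 (by norm_num)⟩ hG

/-- **Slab 3 (t_pd ∈ [1.32, 1.39] eV) of `emeryBoxTl2223IPK11Src (EmeryBoxesKSlicesS)`, ν = 43/100: the antinodal Fermi-surface Cu-d weight of every member lies in `[0.6228, 0.7315]`**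
(normalised-slab v2 corner rule; brackets `faceDirPt_Tl2223IPK11_nH114_s3_lo_br` / `_hi_br`). [folklore] -/
theorem tl2223IPK11Box_dWeightFaceDir_nH114_s3 {Δ a b c : ℝ} (hΔ : Δ ∈ Icc ((37 : ℝ) / 25) ((56 : ℝ) / 25)) (ha : a ∈ Icc ((33 : ℝ) / 25) ((139 : ℝ) / 100)) (hb : b ∈ Icc ((31 : ℝ) / 50) ((73 : ℝ) / 100)) (hc : c ∈ Icc ((3 : ℝ) / 20) ((19 : ℝ) / 100)) :
    dWeightFace Δ a b c (fermiEnergyOf Δ a b c ((43 : ℝ) / 100)) ∈ Icc ((1557 : ℝ) / 2500) ((1463 : ℝ) / 2000) := by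
  have ha0 : 0 < a := lt_of_lt_of_le (by norm_num) ha.1
  rw [dWeightFace_fermiEnergyOf_eq_ratios ha0]
  have hΔn : Δ / a ∈ Icc ((148 : ℝ) / 139) ((56 : ℝ) / 33) := by
    constructor
    · rw [le_div_iff₀ ha0]; linarith [hΔ.1, ha.2]
    · rw [div_le_iff₀ ha0]; linarith [hΔ.2, ha.1]
  have hbn : b / a ∈ Icc ((62 : ℝ) / 139) ((73 : ℝ) / 132) := by
    constructor
    · rw [le_div_iff₀ ha0]; linarith [hb.1, ha.2]
    · rw [div_le_iff₀ ha0]; linarith [hb.2, ha.1]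
  have hcn : c / a ∈ Icc ((15 : ℝ) / 139) ((19 : ℝ) / 132) := by
    constructor
    · rw [le_div_iff₀ ha0]; linarith [hc.1, ha.2]
    · rw [div_le_iff₀ ha0]; linarith [hc.2, ha.1]
  have hVH : ∀ Δ' b' c' : ℝ, Δ' ∈ Icc ((148 : ℝ) / 139) ((56 : ℝ) / 33) → b' ∈ Icc ((62 : ℝ) / 139) ((73 : ℝ) / 132) → c' ∈ Icc ((15 : ℝ) / 139) ((19 : ℝ) / 132) →
      1 - 2 * ((43 : ℝ) / 100) ≤ xVH Δ' 1 b' c' := by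
    intro Δ' b' c' hΔ' hb' hc'
    have h := xVH_window_of_vhBoxCheck (Δ₁ := ((148 : ℚ) / 139)) (Δ₂ := ((56 : ℚ) / 33)) (a₁ := (1 : ℚ)) (a₂ := (1 : ℚ)) (b₁ := ((62 : ℚ) / 139)) (b₂ := ((73 : ℚ) / 132))
      (c₁ := ((15 : ℚ) / 139)) (c₂ := ((19 : ℚ) / 132)) (v₁ := ((11639 : ℚ) / 10000)) (v₂ := ((867 : ℚ) / 625)) (e := ((6707 : ℚ) / 5000)) (E := ((12013 : ℚ) / 10000))
      (q₁ := ((5283 : ℚ) / 10000)) (q₂ := ((183 : ℚ) / 200)) (by decide +kernel)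
      (Δ := Δ') (tpd := 1) (tpp := b') (c := c') (by simpa using hΔ') (by simp) (by simpa using hb') (by simpa using hc')
    obtain ⟨-, -, -, -, -, hwin⟩ := h
    push_cast at hwin
    have ht := vhFrac_21_40
    have hmono := vhFrac_anti (show (21 / 40 : ℝ) ≤ ((5283 : ℝ) / 10000) by norm_num)
    have hnu : ((57496 : ℝ) / 147456) ≤ ((43 : ℝ) / 100) := by norm_num
    linarith [hwin.1, ht.2]
  have hEh := (fermiEnergyOf_of_pointBracketCheck faceDirPt_Tl2223IPK11_nH114_s3_lo_br (by norm_num) (by norm_num) (by norm_num) (ν := (43/100 : ℝ))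
    (by push_cast; exact ⟨le_rfl, le_rfl⟩)).2
  have hEv := (fermiEnergyOf_of_pointBracketCheck faceDirPt_Tl2223IPK11_nH114_s3_hi_br (by norm_num) (by norm_num) (by norm_num) (ν := (43/100 : ℝ))
    (by push_cast; exact ⟨le_rfl, le_rfl⟩)).2
  push_cast at hEh hEv
  refine dWeightFace_fermiEnergyOf_mem_Icc_of_mem_box3_dir_num (Eh := ((7543 : ℝ) / 5000)) (Ev := ((6089 : ℝ) / 5000)) (Elow := ((6039 : ℝ) / 5000)) (κ₀ := 1 / 10) (κ := 1 / 10)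
    (by norm_num) one_pos (by norm_num) (by norm_num) (by norm_num) hΔn hbn hcn (by norm_num) (by norm_num) hVH hEh.2 (by norm_num)
    (by norm_num [faceU, fsD, fsN, cA]) (by norm_num [faceU, fsD, fsN, cA]) (by norm_num [faceU, fsD, fsN, cA]) (by norm_num [faceU, fsD, fsN, cA])
    hEv.1 (by norm_num) (by norm_num) (by norm_num [faceG]) (by norm_num) (by norm_num) (by norm_num) le_rfl (by norm_num [dWeightAxisCF])
    (by norm_num) (by norm_num) ?_ (by norm_num [dWeightFaceLoDec, faceRUp, faceN]) (by norm_num [dWeightFaceCF, faceN, faceR, fsN])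
  intro D B C e hD hB hC he hG
  exact faceDir_nonneg_of_mem_region ⟨le_trans (by norm_num) hD.1, le_trans hD.2 (by norm_num)⟩ ⟨le_trans (by norm_num) he.1, le_trans he.2 (by norm_num)⟩
    ⟨le_trans (by norm_num) hB.1, le_trans hB.2 (by norm_num)⟩ ⟨le_trans (by norm_num) hC.1, le_trans hC.2 (by norm_num)⟩ hG

/-- **`emeryBoxTl2223IPK11Src (EmeryBoxesKSlicesS)`, ν = 43/100: for EVERY member θ the Cu-d weight of the antinodal Fermi-surface state lies in `[0.6228, 0.7503]`** (hull of the 3 t_pd slab windows; regime-free rule v2). [folklore] -/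
theorem tl2223IPK11Box_dWeightFaceDir_nH114 {Δ a b c : ℝ} (hΔ : Δ ∈ Icc ((37 : ℝ) / 25) ((56 : ℝ) / 25)) (ha : a ∈ Icc ((59 : ℝ) / 50) ((139 : ℝ) / 100)) (hb : b ∈ Icc ((31 : ℝ) / 50) ((73 : ℝ) / 100)) (hc : c ∈ Icc ((3 : ℝ) / 20) ((19 : ℝ) / 100)) :
    dWeightFace Δ a b c (fermiEnergyOf Δ a b c ((43 : ℝ) / 100)) ∈ Icc ((1557 : ℝ) / 2500) ((7503 : ℝ) / 10000) := by
  rcases le_or_gt a ((5 : ℝ) / 4) with h1 | h1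
  · have h := tl2223IPK11Box_dWeightFaceDir_nH114_s1 hΔ ⟨ha.1, h1⟩ hb hc
    exact ⟨le_trans (by norm_num) h.1, le_trans h.2 (by norm_num)⟩
  · rcases le_or_gt a ((33 : ℝ) / 25) with h2 | h2
    · have h := tl2223IPK11Box_dWeightFaceDir_nH114_s2 hΔ ⟨h1.le, h2⟩ hb hc
      exact ⟨le_trans (by norm_num) h.1, le_trans h.2 (by norm_num)⟩
    · have h := tl2223IPK11Box_dWeightFaceDir_nH114_s3 hΔ ⟨h2.le, ha.2⟩ hb hc
      exact ⟨le_trans (by norm_num) h.1, le_trans h.2 (by norm_num)⟩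

end Summit.Ventures.CertifiedManyBodySolver.Downfold.Emery
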